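import Literature.MathematicalPhysics.QuantumFieldTheory.Balaban1983to89.B5Eq129FreeResolventGradientRow
import Literature.MathematicalPhysics.QuantumFieldTheory.Balaban1983to89.B5Eq129FreeResolventWeightedGradientRowCosh

/-!
# `Balaban1983to89.B5Eq129FreeResolventWeightedGradientRowOperator` — T. Bałaban, *Propagators and renormalization transformations for lattice gauge
# theories. I*, Commun. Math. Phys. **95** (1984) 17–40 [Balaban1984PropagatorsI] (1.29) p. 23, p. 36, serving [Balaban1985BackgroundPropagators] Thm 3.1
# (3.42) p. 397 (the `|∇G|` line with the weight `e^{−δ₀d(y,y′)}`, flat case): **THE WEIGHTED (K∇) LETTER IN OPERATOR ∕ SOLUTION SHAPE — for vector-valued data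
# `g` with `‖g(y)‖ ≤ F·W_c(y)` and the solution `u` of `(L₀ + m)u = g` on any finite torus: `‖u(x − e_ν) − u(x)‖ ≤ B·F·W_c(x)`,
# `B = (1 + e^{−a})(1 + 2t∕(N_ν√μ))∕√(μ² + 4μt²) + 2 sinh a ∕ λ`** (`W_c` the product-`cosh` weight of `B5Eq129CoshSupersolution`, `μ = m − 2(d−1)t²(cosh a − 1)`,
# `λ = m − 2d·t²(cosh a − 1) > 0` the OWNER's window) — i.e. `‖∇_ν(L₀ + m)⁻¹‖ ≤ B` on `ℓ^∞` with the weight `1∕W_c` (the norm `sup_y ‖·‖∕W_c(y)`), equivalently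
# `sup_x Σ_y |∇_νK(x,y)|·W_c(y)∕W_c(x) ≤ B`: the form in which t4-ne9-idea-1's storey-J dictionary (g129 sheet §4) reads the (K∇) letter; the Green's-function ∕
# translation-invariance step of `B5Eq129FreeResolventGradientRow` §2 composed with `B5Eq129FreeResolventWeightedGradientRowCosh.sum_weight_mul_abs_sub_le_explicit`

statement-level skeleton of published theorems with citation tags; proofs where landed; nothing here is a claim about the Yang–Mills mass gap

CITATION HEADER (lean-in-tree rule).  Audit cell `pub-balaban`, sub-cell `t4`, BINDER row NE9; filed by NE9 crux-team LEAF PROVER 05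
(`b2b-balaban-t4-ne9-formalise-leaf-05`, gen 81).  OBJECT: [Balaban1984PropagatorsI] (1.29) p. 23's free stencil in the (FS) encoding (vector-valued solution `u` of
`(L₀ + m)u = g` as a HYPOTHESIS) and the p. 36 weight as written in `B5Eq129CoshSupersolution`; no `def`.  CONTENT: [folklore] composition BY NAME.  Nothing of print
is asserted.

WHAT IS PROVED (sorry-free; proof lane — 0 `def`).
* **`green_eq_kernel_sub`** — translation invariance `G(z, y) = G(z − y, 0)` of any Green's function of `L₀ + m` (uniqueness, `B5Eq129FreeResolventKernelMonotone.eq_of_resolvent_eq`).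
* **`sum_weight_mul_abs_green_sub_le`** — `Σ_y W_c(y)·|G(x − e_ν, y) − G(x, y)| ≤ B·W_c(x)` for every `x`, `ν`, centre `c` (the row form).
* **`norm_apply_sub_le_of_resolvent_weighted`** — the displayed SOLUTION shape (`ℓ^∞` with the weight `1∕W_c`).
* §2 **`sum_weight_mul_abs_green_sub_col_le`** — the COLUMN form `Σ_x W_c(x)·|G(x − e_ν, y) − G(x, y)| ≤ B·W_c(y)`; **`sum_weight_mul_norm_apply_sub_le`** — the dual
  `ℓ¹_{W_c}` shape `Σ_x W_c(x)·‖u(x − e_ν) − u(x)‖ ≤ B·Σ_y W_c(y)·‖g(y)‖` (the sheet's «operator norm on `ℓ¹_w`»).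
* §3 **`sum_weight_mul_abs_green_sub_le_self`** — the weight centred AT THE OUTPUT SITE (`c = x`, the sheet's `w(y)∕w(x)` with `w = W_x`, `W_x(x) = 1`):
  `Σ_y W_x(y)·|G(x − e_ν, y) − G(x, y)| ≤ B′`, `B′ = (1 + e^{−a})(1 + 2t∕(N_ν√μ))∕√(μ² + 4μt²) + sinh a∕λ` (the sharper on-slice bracket: the reduced centre is `0`).
HONEST SCOPE.  FLAT (`U = 1`) stencil; composition only.  ONE letter of ONE un-opened storey (J) of row L13; behind the model wall O-NE9-1 NOT a letter of (3.42) for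
`G′_k(U)`; NOT Tier P, NOT NE9 (cell pub-balaban: NE9 NOT PRINTED ∕ NOT PROVED; «NE9 ⇐ the named binders»; row WALLED ON A MODEL (O-NE9-1; #5 UNRULED); spine
PROVED 0∕9; rung (B)+1 finite T⁴ — NOT infinite volume, NOT mass gap, NOT BetaPertH, NOT Clay).  HONEST DEPENDENCY: continuum YM on T⁴ ⇐ BetaPertH ∧ nine spine
estimates (0/9 proved); BetaPertH ⇐ (D1) ∧ (D4) ∧ CAP+tail; G-an2-4 gates asym, D1 and NE2/3/4.  NEW file importing `B5Eq129FreeResolventGradientRow` and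
`B5Eq129FreeResolventWeightedGradientRowCosh`; nothing modified.  Net new unproved facts: 0.
-/

noncomputable section

open scoped BigOperators

namespace Literature.MathematicalPhysics.QuantumFieldTheory.Balaban1983to89.B5Eq129FreeResolventWeightedGradientRowOperator

open B5Prop11Plancherel (Tor unitVec)
open B4TorusKernel.MultiPeriod (circAbs)
open B5Eq129FreeResolventKernelMonotone (eq_of_resolvent_eq)
open B5Eq129FreeResolventGradientRow (exists_green apply_eq_sum_green_smul)
open B5Eq129CoshWeightFactorLetters (circAbs_neg_val)
open B5Eq129FreeResolventWeightedGradientRowCosh (sum_weight_mul_abs_sub_le_explicit sum_weight_mul_abs_sub_le_of_centre_on_slice_explicit)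

variable {d : ℕ} (N : Fin d → ℕ) [∀ μ, NeZero (N μ)]

/-- **TRANSLATION INVARIANCE OF THE GREEN's FUNCTION**: if `(L₀ + m)G(·, y) = δ_y` for every `y`, then `G(z, y) = G(z − y, 0)` (uniqueness of the resolvent
solution, `B5Eq129FreeResolventKernelMonotone.eq_of_resolvent_eq`; the step inside `B5Eq129FreeResolventGradientRow.sum_abs_green_sub_le`). [folklore]
[cite: Balaban1984PropagatorsI, (1.29) p.23] -/
theorem green_eq_kernel_sub (t : ℝ) {m : ℝ} (hm : 0 < m) {G : Tor N → Tor N → ℝ}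
    (hG : ∀ y x, ∑ ν, t ^ 2 * ((G x y - G (x - unitVec N ν) y) + (G x y - G (x + unitVec N ν) y)) + m * G x y =
      if x = y then 1 else 0) (y z : Tor N) : G z y = G (z - y) 0 := by
  have hk : ∀ w, ∑ ν, t ^ 2 * ((G w 0 - G (w - unitVec N ν) 0) + (G w 0 - G (w + unitVec N ν) 0)) + m * G w 0 =
      if w = 0 then 1 else 0 := fun w => hG 0 w
  have h := eq_of_resolvent_eq (V := Tor N) (ι := Fin d) (fun μ w => w - unitVec N μ) (fun μ w => w + unitVec N μ)
    (sq_nonneg t) hm (φ₁ := fun w => G (w + y) y) (φ₂ := fun w => G w 0) (ψ := fun w => if w = 0 then (1 : ℝ) else 0) ?_ hk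
  · have := congrFun h (z - y)
    simpa only [sub_add_cancel] using this
  · intro w
    have e := hG y (w + y)
    simp only [add_sub_right_comm, add_right_comm w y, add_eq_right] at e
    simpa only [add_right_comm w _ y] using e

/-- **THE WEIGHTED ROW OF THE GREEN's FUNCTION, EVERY OUTPUT SITE AND EVERY CENTRE**: in the OWNER's window `2d·t²(cosh a − 1) < m` (`t > 0`, `a ≥ 0`, `N_ν ≥ 2`),
`Σ_y W_c(y)·|G(x − e_ν, y) − G(x, y)| ≤ B·W_c(x)` with `B = (1 + e^{−a})(1 + 2t∕(N_ν√μ))∕√(μ² + 4μt²) + 2 sinh a ∕ (m − 2d·t²(cosh a − 1))`,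
`μ = m − 2(d−1)t²(cosh a − 1)` — i.e. `sup_x Σ_y |∇_νG(x,y)|·W_c(y)∕W_c(x) ≤ B` (t4-ne9-idea-1 g129 §4's reading of the (K∇) letter): translation invariance puts the
source at `0` and the centre at `x − c` (`B5Eq129FreeResolventWeightedGradientRowCosh.sum_weight_mul_abs_sub_le_explicit`; the torus distance is even,
`B5Eq129CoshWeightFactorLetters.circAbs_neg_val`). [folklore] [cite: Balaban1984PropagatorsI, (1.29) p.23, p.36; Balaban1985BackgroundPropagators, Thm 3.1 (3.42) p.397] -/
theorem sum_weight_mul_abs_green_sub_le (t : ℝ) (ht : 0 < t) {m a : ℝ} (hm : 0 < m) (ha : 0 ≤ a)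
    (hlam : 2 * (d : ℝ) * t ^ 2 * (Real.cosh a - 1) < m) {G : Tor N → Tor N → ℝ}
    (hG : ∀ y x, ∑ ν, t ^ 2 * ((G x y - G (x - unitVec N ν) y) + (G x y - G (x + unitVec N ν) y)) + m * G x y =
      if x = y then 1 else 0)
    (ν : Fin d) (hn : 2 ≤ N ν) (c x : Tor N) :
    ∑ y : Tor N, (∏ μ, Real.cosh (a * (circAbs (N μ) ((c μ - y μ : ZMod (N μ)).val) : ℝ))) * |G (x - unitVec N ν) y - G x y| ≤
      ((1 + Real.exp (-a)) * ((1 + 2 * t / (N ν * Real.sqrt (m - 2 * ((d : ℝ) - 1) * t ^ 2 * (Real.cosh a - 1)))) /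
            Real.sqrt ((m - 2 * ((d : ℝ) - 1) * t ^ 2 * (Real.cosh a - 1)) ^ 2 + 4 * (m - 2 * ((d : ℝ) - 1) * t ^ 2 * (Real.cosh a - 1)) * t ^ 2)) +
          2 * Real.sinh a / (m - 2 * (d : ℝ) * t ^ 2 * (Real.cosh a - 1))) *
        ∏ μ, Real.cosh (a * (circAbs (N μ) ((c μ - x μ : ZMod (N μ)).val) : ℝ)) := by
  classical
  -- the kernel and translation invariance
  have hk : ∀ w, ∑ ν, t ^ 2 * ((G w 0 - G (w - unitVec N ν) 0) + (G w 0 - G (w + unitVec N ν) 0)) + m * G w 0 =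
      if w = 0 then 1 else 0 := fun w => hG 0 w
  have htr : ∀ y z, G z y = G (z - y) 0 := green_eq_kernel_sub N t hm hG
  -- the weight centred at `c`, evaluated at `x − z`, is the weight centred at `x − c`, evaluated at `z`
  have hW : ∀ z : Tor N, (∏ μ, Real.cosh (a * (circAbs (N μ) ((c μ - (x - z) μ : ZMod (N μ)).val) : ℝ))) =
      ∏ μ, Real.cosh (a * (circAbs (N μ) (((x - c) μ - z μ : ZMod (N μ)).val) : ℝ)) := fun z =>
    Finset.prod_congr rfl fun μ _ => by
      rw [show (c μ - (x - z) μ : ZMod (N μ)) = -((x - c) μ - z μ) by simp only [Pi.sub_apply]; ring, circAbs_neg_val]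
  have hW0 : (∏ μ, Real.cosh (a * (circAbs (N μ) (((x - c) μ - (0 : Tor N) μ : ZMod (N μ)).val) : ℝ))) =
      ∏ μ, Real.cosh (a * (circAbs (N μ) ((c μ - x μ : ZMod (N μ)).val) : ℝ)) :=
    Finset.prod_congr rfl fun μ _ => by
      rw [show ((x - c) μ - (0 : Tor N) μ : ZMod (N μ)) = -(c μ - x μ) by simp only [Pi.sub_apply, Pi.zero_apply]; ring, circAbs_neg_val]
  -- reindex `y = x − z`
  have hre : ∑ y : Tor N, (∏ μ, Real.cosh (a * (circAbs (N μ) ((c μ - y μ : ZMod (N μ)).val) : ℝ))) * |G (x - unitVec N ν) y - G x y| =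
      ∑ z : Tor N, (∏ μ, Real.cosh (a * (circAbs (N μ) (((x - c) μ - z μ : ZMod (N μ)).val) : ℝ))) *
        |G (z - unitVec N ν) 0 - G z 0| := by
    refine Fintype.sum_equiv (Equiv.subLeft x) _ _ fun y => ?_
    simp only [Equiv.subLeft_apply]
    rw [htr y (x - unitVec N ν), htr y x, ← hW (x - y), sub_sub_cancel, sub_right_comm]
  rw [hre, ← hW0, mul_comm]
  exact sum_weight_mul_abs_sub_le_explicit N t ht hm ha hlam hk ν hn (x - c)

/-- **THE WEIGHTED (K∇) LETTER IN SOLUTION SHAPE**: for vector-valued data `g` with `‖g(y)‖ ≤ F·W_c(y)` and the solution `u` of `(L₀ + m)u = g` on any finite torus,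
in the OWNER's window: `‖u(x − e_ν) − u(x)‖ ≤ B·F·W_c(x)` with the `B` of `sum_weight_mul_abs_green_sub_le` — the operator `∇_ν(L₀ + m)⁻¹` has norm `≤ B` on `ℓ^∞`
with the weight `1∕W_c` (`‖h‖ := sup_y ‖h(y)‖∕W_c(y)`), uniformly in `d`, the periods (`N_ν ≥ 2`), the centre and the output site; height-free in the units `t = η⁻¹`,
`a = κη` after the consumer's `η⁻¹`. [folklore] [cite: Balaban1984PropagatorsI, (1.29) p.23, p.36; Balaban1985BackgroundPropagators, Thm 3.1 (3.42) p.397] -/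
theorem norm_apply_sub_le_of_resolvent_weighted {V : Type*} [NormedAddCommGroup V] [NormedSpace ℝ V] (t : ℝ) (ht : 0 < t) {m a : ℝ}
    (hm : 0 < m) (ha : 0 ≤ a) (hlam : 2 * (d : ℝ) * t ^ 2 * (Real.cosh a - 1) < m)
    {u g : Tor N → V} (hu : ∀ x, ∑ ν, t ^ 2 • ((u x - u (x - unitVec N ν)) + (u x - u (x + unitVec N ν))) + m • u x = g x)
    (c : Tor N) {F : ℝ} (hg : ∀ y, ‖g y‖ ≤ F * ∏ μ, Real.cosh (a * (circAbs (N μ) ((c μ - y μ : ZMod (N μ)).val) : ℝ)))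
    (ν : Fin d) (hn : 2 ≤ N ν) (x : Tor N) :
    ‖u (x - unitVec N ν) - u x‖ ≤
      ((1 + Real.exp (-a)) * ((1 + 2 * t / (N ν * Real.sqrt (m - 2 * ((d : ℝ) - 1) * t ^ 2 * (Real.cosh a - 1)))) /
            Real.sqrt ((m - 2 * ((d : ℝ) - 1) * t ^ 2 * (Real.cosh a - 1)) ^ 2 + 4 * (m - 2 * ((d : ℝ) - 1) * t ^ 2 * (Real.cosh a - 1)) * t ^ 2)) +
          2 * Real.sinh a / (m - 2 * (d : ℝ) * t ^ 2 * (Real.cosh a - 1))) *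
        F * ∏ μ, Real.cosh (a * (circAbs (N μ) ((c μ - x μ : ZMod (N μ)).val) : ℝ)) := by
  classical
  obtain ⟨G, hG⟩ := exists_green N t hm
  have hW1 : ∀ y : Tor N, 0 < ∏ μ, Real.cosh (a * (circAbs (N μ) ((c μ - y μ : ZMod (N μ)).val) : ℝ)) := fun y =>
    Finset.prod_pos fun _ _ => Real.cosh_pos _
  have hF : 0 ≤ F := by
    have h0 := hg 0
    exact nonneg_of_mul_nonneg_left ((norm_nonneg _).trans h0) (hW1 0)
  rw [apply_eq_sum_green_smul N t hm hG hu, apply_eq_sum_green_smul N t hm hG hu, ← Finset.sum_sub_distrib]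
  calc ‖∑ y, (G (x - unitVec N ν) y • g y - G x y • g y)‖
      ≤ ∑ y, ‖G (x - unitVec N ν) y • g y - G x y • g y‖ := norm_sum_le _ _
    _ ≤ ∑ y, (∏ μ, Real.cosh (a * (circAbs (N μ) ((c μ - y μ : ZMod (N μ)).val) : ℝ))) * |G (x - unitVec N ν) y - G x y| * F :=
        Finset.sum_le_sum fun y _ => by
          rw [← sub_smul, norm_smul, Real.norm_eq_abs]
          have := mul_le_mul_of_nonneg_left (hg y) (abs_nonneg (G (x - unitVec N ν) y - G x y))
          linarith [this]
    _ = (∑ y, (∏ μ, Real.cosh (a * (circAbs (N μ) ((c μ - y μ : ZMod (N μ)).val) : ℝ))) * |G (x - unitVec N ν) y - G x y|) * F :=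
        (Finset.sum_mul _ _ _).symm
    _ ≤ _ := by
        have h := sum_weight_mul_abs_green_sub_le N t ht hm ha hlam hG ν hn c x
        have := mul_le_mul_of_nonneg_right h hF
        linarith [this]

/-! ## §2 The column form and the dual `ℓ¹_{W_c}` shape -/

/-- **THE WEIGHTED COLUMN OF THE GREEN's FUNCTION**: in the OWNER's window, for every input site `y` and every centre `c`:
`Σ_x W_c(x)·|G(x − e_ν, y) − G(x, y)| ≤ B·W_c(y)` (reindex `x = z + y`: `W_c(z + y) = W_{c−y}(z)`, then `sum_weight_mul_abs_sub_le_explicit` at centre `c − y`,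
`W_{c−y}(0) = W_c(y)`). [folklore] [cite: Balaban1984PropagatorsI, (1.29) p.23, p.36; Balaban1985BackgroundPropagators, Thm 3.1 (3.42) p.397] -/
theorem sum_weight_mul_abs_green_sub_col_le (t : ℝ) (ht : 0 < t) {m a : ℝ} (hm : 0 < m) (ha : 0 ≤ a)
    (hlam : 2 * (d : ℝ) * t ^ 2 * (Real.cosh a - 1) < m) {G : Tor N → Tor N → ℝ}
    (hG : ∀ y x, ∑ ν, t ^ 2 * ((G x y - G (x - unitVec N ν) y) + (G x y - G (x + unitVec N ν) y)) + m * G x y =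
      if x = y then 1 else 0)
    (ν : Fin d) (hn : 2 ≤ N ν) (c y : Tor N) :
    ∑ x : Tor N, (∏ μ, Real.cosh (a * (circAbs (N μ) ((c μ - x μ : ZMod (N μ)).val) : ℝ))) * |G (x - unitVec N ν) y - G x y| ≤
      ((1 + Real.exp (-a)) * ((1 + 2 * t / (N ν * Real.sqrt (m - 2 * ((d : ℝ) - 1) * t ^ 2 * (Real.cosh a - 1)))) /
            Real.sqrt ((m - 2 * ((d : ℝ) - 1) * t ^ 2 * (Real.cosh a - 1)) ^ 2 + 4 * (m - 2 * ((d : ℝ) - 1) * t ^ 2 * (Real.cosh a - 1)) * t ^ 2)) +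
          2 * Real.sinh a / (m - 2 * (d : ℝ) * t ^ 2 * (Real.cosh a - 1))) *
        ∏ μ, Real.cosh (a * (circAbs (N μ) ((c μ - y μ : ZMod (N μ)).val) : ℝ)) := by
  classical
  have hk : ∀ w, ∑ ν, t ^ 2 * ((G w 0 - G (w - unitVec N ν) 0) + (G w 0 - G (w + unitVec N ν) 0)) + m * G w 0 =
      if w = 0 then 1 else 0 := fun w => hG 0 w
  have htr : ∀ y z, G z y = G (z - y) 0 := green_eq_kernel_sub N t hm hG
  have hW : ∀ z : Tor N, (∏ μ, Real.cosh (a * (circAbs (N μ) ((c μ - (z + y) μ : ZMod (N μ)).val) : ℝ))) =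
      ∏ μ, Real.cosh (a * (circAbs (N μ) (((c - y) μ - z μ : ZMod (N μ)).val) : ℝ)) := fun z =>
    Finset.prod_congr rfl fun μ _ => by
      rw [show (c μ - (z + y) μ : ZMod (N μ)) = (c - y) μ - z μ by simp only [Pi.sub_apply, Pi.add_apply]; ring]
  have hW0 : (∏ μ, Real.cosh (a * (circAbs (N μ) (((c - y) μ - (0 : Tor N) μ : ZMod (N μ)).val) : ℝ))) =
      ∏ μ, Real.cosh (a * (circAbs (N μ) ((c μ - y μ : ZMod (N μ)).val) : ℝ)) :=
    Finset.prod_congr rfl fun μ _ => by simp only [Pi.sub_apply, Pi.zero_apply, sub_zero]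
  have hre : ∑ x : Tor N, (∏ μ, Real.cosh (a * (circAbs (N μ) ((c μ - x μ : ZMod (N μ)).val) : ℝ))) * |G (x - unitVec N ν) y - G x y| =
      ∑ z : Tor N, (∏ μ, Real.cosh (a * (circAbs (N μ) (((c - y) μ - z μ : ZMod (N μ)).val) : ℝ))) *
        |G (z - unitVec N ν) 0 - G z 0| := by
    refine Fintype.sum_equiv (Equiv.subRight y) _ _ fun x => ?_
    simp only [Equiv.subRight_apply]
    rw [htr y (x - unitVec N ν), htr y x, ← hW (x - y), sub_add_cancel, sub_right_comm]
  rw [hre, ← hW0, mul_comm]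
  exact sum_weight_mul_abs_sub_le_explicit N t ht hm ha hlam hk ν hn (c - y)

/-- **THE WEIGHTED (K∇) LETTER IN THE DUAL `ℓ¹_{W_c}` SHAPE**: for vector-valued data `g` and the solution `u` of `(L₀ + m)u = g`, in the OWNER's window:
`Σ_x W_c(x)·‖u(x − e_ν) − u(x)‖ ≤ B·Σ_y W_c(y)·‖g(y)‖` — `∇_ν(L₀ + m)⁻¹` has norm `≤ B` on `ℓ¹` with the weight `W_c` (Fubini + the column form).
[folklore] [cite: Balaban1984PropagatorsI, (1.29) p.23, p.36; Balaban1985BackgroundPropagators, Thm 3.1 (3.42) p.397] -/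
theorem sum_weight_mul_norm_apply_sub_le {V : Type*} [NormedAddCommGroup V] [NormedSpace ℝ V] (t : ℝ) (ht : 0 < t) {m a : ℝ}
    (hm : 0 < m) (ha : 0 ≤ a) (hlam : 2 * (d : ℝ) * t ^ 2 * (Real.cosh a - 1) < m)
    {u g : Tor N → V} (hu : ∀ x, ∑ ν, t ^ 2 • ((u x - u (x - unitVec N ν)) + (u x - u (x + unitVec N ν))) + m • u x = g x)
    (c : Tor N) (ν : Fin d) (hn : 2 ≤ N ν) :
    ∑ x : Tor N, (∏ μ, Real.cosh (a * (circAbs (N μ) ((c μ - x μ : ZMod (N μ)).val) : ℝ))) * ‖u (x - unitVec N ν) - u x‖ ≤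
      ((1 + Real.exp (-a)) * ((1 + 2 * t / (N ν * Real.sqrt (m - 2 * ((d : ℝ) - 1) * t ^ 2 * (Real.cosh a - 1)))) /
            Real.sqrt ((m - 2 * ((d : ℝ) - 1) * t ^ 2 * (Real.cosh a - 1)) ^ 2 + 4 * (m - 2 * ((d : ℝ) - 1) * t ^ 2 * (Real.cosh a - 1)) * t ^ 2)) +
          2 * Real.sinh a / (m - 2 * (d : ℝ) * t ^ 2 * (Real.cosh a - 1))) *
        ∑ y : Tor N, (∏ μ, Real.cosh (a * (circAbs (N μ) ((c μ - y μ : ZMod (N μ)).val) : ℝ))) * ‖g y‖ := by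
  classical
  obtain ⟨G, hG⟩ := exists_green N t hm
  set B : ℝ := (1 + Real.exp (-a)) * ((1 + 2 * t / (N ν * Real.sqrt (m - 2 * ((d : ℝ) - 1) * t ^ 2 * (Real.cosh a - 1)))) /
            Real.sqrt ((m - 2 * ((d : ℝ) - 1) * t ^ 2 * (Real.cosh a - 1)) ^ 2 + 4 * (m - 2 * ((d : ℝ) - 1) * t ^ 2 * (Real.cosh a - 1)) * t ^ 2)) +
          2 * Real.sinh a / (m - 2 * (d : ℝ) * t ^ 2 * (Real.cosh a - 1)) with hB
  set W : Tor N → ℝ := fun x => ∏ μ, Real.cosh (a * (circAbs (N μ) ((c μ - x μ : ZMod (N μ)).val) : ℝ)) with hWdef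
  have hW0 : ∀ x, 0 ≤ W x := fun x => Finset.prod_nonneg fun _ _ => (Real.cosh_pos _).le
  -- pointwise: ‖u(x − e_ν) − u(x)‖ ≤ Σ_y |ΔG(x,y)|·‖g y‖
  have hpt : ∀ x, ‖u (x - unitVec N ν) - u x‖ ≤ ∑ y, |G (x - unitVec N ν) y - G x y| * ‖g y‖ := by
    intro x
    rw [apply_eq_sum_green_smul N t hm hG hu, apply_eq_sum_green_smul N t hm hG hu, ← Finset.sum_sub_distrib]
    refine (norm_sum_le _ _).trans (Finset.sum_le_sum fun y _ => ?_)
    rw [← sub_smul, norm_smul, Real.norm_eq_abs]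
  -- the column bound
  have hcol : ∀ y, ∑ x, W x * |G (x - unitVec N ν) y - G x y| ≤ B * W y := fun y =>
    sum_weight_mul_abs_green_sub_col_le N t ht hm ha hlam hG ν hn c y
  calc ∑ x, W x * ‖u (x - unitVec N ν) - u x‖
      ≤ ∑ x, W x * ∑ y, |G (x - unitVec N ν) y - G x y| * ‖g y‖ :=
        Finset.sum_le_sum fun x _ => mul_le_mul_of_nonneg_left (hpt x) (hW0 x)
    _ = ∑ y, (∑ x, W x * |G (x - unitVec N ν) y - G x y|) * ‖g y‖ := by
        simp_rw [Finset.mul_sum, Finset.sum_mul]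
        rw [Finset.sum_comm]
        exact Finset.sum_congr rfl fun y _ => Finset.sum_congr rfl fun x _ => by ring
    _ ≤ ∑ y, (B * W y) * ‖g y‖ := Finset.sum_le_sum fun y _ => mul_le_mul_of_nonneg_right (hcol y) (norm_nonneg _)
    _ = B * ∑ y, W y * ‖g y‖ := by rw [Finset.mul_sum]; exact Finset.sum_congr rfl fun y _ => by ring

/-! ## §3 The weight centred at the output site: the sharper on-slice constant -/

/-- **THE WEIGHTED ROW WITH THE WEIGHT CENTRED AT THE OUTPUT SITE** (`c = x`; t4-ne9-idea-1's `Σ_y |∇_νK(x,y)|·w(y)∕w(x)` for `w = W_x`, `W_x(x) = 1`): in the OWNER's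
window, `Σ_y W_x(y)·|G(x − e_ν, y) − G(x, y)| ≤ (1 + e^{−a})(1 + 2t∕(N_ν√μ))∕√(μ² + 4μt²) + sinh a ∕ λ` — the reduction of `sum_weight_mul_abs_green_sub_le` lands at
centre `x − x = 0`, ON the source slice, where `B5Eq129FreeResolventWeightedGradientRowCosh.sum_weight_mul_abs_sub_le_of_centre_on_slice_explicit` gives `sinh a∕λ`
instead of `2 sinh a∕λ`. [folklore] [cite: Balaban1984PropagatorsI, (1.29) p.23, p.36; Balaban1985BackgroundPropagators, Thm 3.1 (3.42) p.397] -/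
theorem sum_weight_mul_abs_green_sub_le_self (t : ℝ) (ht : 0 < t) {m a : ℝ} (hm : 0 < m) (ha : 0 ≤ a)
    (hlam : 2 * (d : ℝ) * t ^ 2 * (Real.cosh a - 1) < m) {G : Tor N → Tor N → ℝ}
    (hG : ∀ y x, ∑ ν, t ^ 2 * ((G x y - G (x - unitVec N ν) y) + (G x y - G (x + unitVec N ν) y)) + m * G x y =
      if x = y then 1 else 0)
    (ν : Fin d) (hn : 2 ≤ N ν) (x : Tor N) :
    ∑ y : Tor N, (∏ μ, Real.cosh (a * (circAbs (N μ) ((x μ - y μ : ZMod (N μ)).val) : ℝ))) * |G (x - unitVec N ν) y - G x y| ≤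
      (1 + Real.exp (-a)) * ((1 + 2 * t / (N ν * Real.sqrt (m - 2 * ((d : ℝ) - 1) * t ^ 2 * (Real.cosh a - 1)))) /
          Real.sqrt ((m - 2 * ((d : ℝ) - 1) * t ^ 2 * (Real.cosh a - 1)) ^ 2 + 4 * (m - 2 * ((d : ℝ) - 1) * t ^ 2 * (Real.cosh a - 1)) * t ^ 2)) +
        Real.sinh a / (m - 2 * (d : ℝ) * t ^ 2 * (Real.cosh a - 1)) := by
  classical
  have hk : ∀ w, ∑ ν, t ^ 2 * ((G w 0 - G (w - unitVec N ν) 0) + (G w 0 - G (w + unitVec N ν) 0)) + m * G w 0 =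
      if w = 0 then 1 else 0 := fun w => hG 0 w
  have htr : ∀ y z, G z y = G (z - y) 0 := green_eq_kernel_sub N t hm hG
  -- the weight centred at `x`, evaluated at `x − z`, is the weight centred at `0`, evaluated at `z`
  have hW : ∀ z : Tor N, (∏ μ, Real.cosh (a * (circAbs (N μ) ((x μ - (x - z) μ : ZMod (N μ)).val) : ℝ))) =
      ∏ μ, Real.cosh (a * (circAbs (N μ) (((0 : Tor N) μ - z μ : ZMod (N μ)).val) : ℝ)) := fun z =>
    Finset.prod_congr rfl fun μ _ => by
      rw [show (x μ - (x - z) μ : ZMod (N μ)) = -((0 : Tor N) μ - z μ) by simp only [Pi.sub_apply, Pi.zero_apply]; ring, circAbs_neg_val]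
  have hW0 : (∏ μ, Real.cosh (a * (circAbs (N μ) (((0 : Tor N) μ - (0 : Tor N) μ : ZMod (N μ)).val) : ℝ))) = 1 :=
    Finset.prod_eq_one fun μ _ => by
      rw [sub_self, ZMod.val_zero, Nat.cast_zero, B4Sect5Torus.circAbs_zero, Int.cast_zero, mul_zero, Real.cosh_zero]
  have hre : ∑ y : Tor N, (∏ μ, Real.cosh (a * (circAbs (N μ) ((x μ - y μ : ZMod (N μ)).val) : ℝ))) * |G (x - unitVec N ν) y - G x y| =
      ∑ z : Tor N, (∏ μ, Real.cosh (a * (circAbs (N μ) (((0 : Tor N) μ - z μ : ZMod (N μ)).val) : ℝ))) *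
        |G (z - unitVec N ν) 0 - G z 0| := by
    refine Fintype.sum_equiv (Equiv.subLeft x) _ _ fun y => ?_
    simp only [Equiv.subLeft_apply]
    rw [htr y (x - unitVec N ν), htr y x, ← hW (x - y), sub_sub_cancel, sub_right_comm]
  rw [hre]
  have h := sum_weight_mul_abs_sub_le_of_centre_on_slice_explicit N t ht hm ha hlam hk ν hn 0 rfl
  rwa [hW0, one_mul] at h

end Literature.MathematicalPhysics.QuantumFieldTheory.Balaban1983to89.B5Eq129FreeResolventWeightedGradientRowOperator

end
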